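import Summits.AnomalousDissipation.AnomalousDissipation.Theorems.SolenoidalFractalHomogenisationLagrangianStepVmodThetaRung
import HarnessLib

/-!
# K1L_D (stmt-AnomalousDissipation-27980), RULING D28-3 (2)(c): the anchor rung for the GRADED (V_θ) clause `VmodDist.SlowVectorClauseFθg`
(helper; `--supports … --as helper`; prover lead-k1l-onelevel-p1 g6; twin of …VmodThetaRung for the text of record of amendment 2 of …VmodDistortedDefs.)

* `clauseFθ_zero_of_clauseFθg` — the certifier's ANCHOR (planner ad-ideate-p5 g15, `Lines/onelevel_vtheta_graded.lean`, verbatim): for `0 < σ`,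
  `0 ≤ θV`, the graded clause at radius `θV` gives the ungraded (V_θ) at radius `0` (`0 ^ σ = 0`); with `noExF_of_clauseFθ le_rfl` this is (V)
  without existence — the composition line of v28 (`hV := slowVectorClauseF_of_noExF_familyS … (noExF_of_clauseFθ le_rfl (clauseFθ_zero_of_clauseFθg hσ hθV.le hVθ'))`).
* `clauseFθg_zero_of_clauseFθ`, `clauseFθg_zero_of_noExF` — the N6 rung forward: (V) without existence implies the graded clause at `θV = 0`
  (the family is `{G₀ = 1}`, the extra allowance is `0 ^ σ = 0`), so `Fθg … 0` is wired correctly at its anchor (BC5-style witness; the clause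
  at `θV = 0` is NOT vacuous and NOT stronger than (V)).
`sorry`-free; NOT a proof of (V) or (V_θ) for any `θV > 0`; K1L_D open; AD NOT proved; rung F-D1.A0.
-/

set_option linter.dupNamespace false

noncomputable section

namespace Summit.AnomalousDissipation.AnomalousDissipation.Theorems.SolenoidalFractalHomogenisation.LagrangianStep.VmodDist

open Literature.Analysis Literature.Analysis.FluidPDE Literature.Analysis.FunctionSpaces
open MeasureTheory Set
open scoped InnerProductSpace

/-- ANCHOR (certifier p5 g15, verbatim): the `θ = 0` member of the graded family is the ungraded (V_θ) at radius `0` (hence, by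
`noExF_of_clauseFθ le_rfl` (…VmodThetaRung), the (V) clause without existence): `0 ^ σ = 0` for `σ ≠ 0`. -/
theorem clauseFθ_zero_of_clauseFθg {k : ℕ} {W : LatticeShear.LatticeWord k} {M : ℝ} {hM : 0 < M} {c : ℝ}
    {Φ : ℝ → Torus.Visc4 (Fin 3) → Torus.Visc4 (Fin 3)} {lo hi Λ β σ C ν₀ K θV : ℝ} (hσ : 0 < σ) (hθV : 0 ≤ θV)
    (h : SlowVectorClauseFθg W M hM c Φ lo hi Λ β σ C ν₀ K θV) : SlowVectorClauseFθ W M hM c Φ lo hi Λ β σ C ν₀ K 0 := by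
  intro G₀ hdet hG ν hν n 𝔸 h1 h2 ℓ hℓ hres p hp hperp T hT w v hw hv
  have key := h 0 ⟨le_rfl, hθV⟩ G₀ hdet hG ν hν n 𝔸 h1 h2 ℓ hℓ hres p hp hperp T hT w v hw hv
  have h0 : (0:ℝ) ^ σ = 0 := Real.zero_rpow hσ.ne'
  simp only [h0, add_zero] at key
  exact key

/-- The ungraded (V_θ) at radius `0` implies the GRADED clause at radius `0` (for `0 < σ`: the only grade is `θ = 0`, and `0 ^ σ = 0`). [folklore] -/
theorem clauseFθg_zero_of_clauseFθ {k : ℕ} {W : LatticeShear.LatticeWord k} {M : ℝ} {hM : 0 < M} {c : ℝ}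
    {Φ : ℝ → Torus.Visc4 (Fin 3) → Torus.Visc4 (Fin 3)} {lo hi Λ β σ C ν₀ K : ℝ} (hσ : 0 < σ)
    (h : SlowVectorClauseFθ W M hM c Φ lo hi Λ β σ C ν₀ K 0) : SlowVectorClauseFθg W M hM c Φ lo hi Λ β σ C ν₀ K 0 := by
  intro θ hθ G₀ hdet hG ν hν n 𝔸 h1 h2 ℓ hℓ hres p hp hperp T hT w v hw hv
  obtain rfl : θ = 0 := le_antisymm hθ.2 hθ.1
  have key := h G₀ hdet hG ν hν n 𝔸 h1 h2 ℓ hℓ hres p hp hperp T hT w v hw hv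
  have h0 : (0:ℝ) ^ σ = 0 := Real.zero_rpow hσ.ne'
  simp only [h0, add_zero]
  exact key

/-- **N6 rung, forward, for the text of record: (V) without existence implies the GRADED (V_θ) clause at `θV = 0`** (for `0 < σ`). -/
theorem clauseFθg_zero_of_noExF {k : ℕ} {W : LatticeShear.LatticeWord k} {M : ℝ} {hM : 0 < M} {c : ℝ}
    {Φ : ℝ → Torus.Visc4 (Fin 3) → Torus.Visc4 (Fin 3)} {lo hi Λ β σ C ν₀ K : ℝ} (hσ : 0 < σ)
    (h : SlowVectorClauseNoExF W M hM c Φ lo hi Λ β σ C ν₀ K) : SlowVectorClauseFθg W M hM c Φ lo hi Λ β σ C ν₀ K 0 :=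
  clauseFθg_zero_of_clauseFθ hσ (clauseFθ_zero_of_noExF h)

/-- … and backward: the graded clause at any `θV ≥ 0` implies (V) without existence (for `0 < σ`). -/
theorem noExF_of_clauseFθg {k : ℕ} {W : LatticeShear.LatticeWord k} {M : ℝ} {hM : 0 < M} {c : ℝ}
    {Φ : ℝ → Torus.Visc4 (Fin 3) → Torus.Visc4 (Fin 3)} {lo hi Λ β σ C ν₀ K θV : ℝ} (hσ : 0 < σ) (hθV : 0 ≤ θV)
    (h : SlowVectorClauseFθg W M hM c Φ lo hi Λ β σ C ν₀ K θV) : SlowVectorClauseNoExF W M hM c Φ lo hi Λ β σ C ν₀ K :=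
  noExF_of_clauseFθ le_rfl (clauseFθ_zero_of_clauseFθg hσ hθV h)

end Summit.AnomalousDissipation.AnomalousDissipation.Theorems.SolenoidalFractalHomogenisation.LagrangianStep.VmodDist

end
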